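import Literature.NumberTheory.Automorphic.Liu2021.LemD1AsPrinted
import Literature.NumberTheory.Automorphic.AdicCompletionLocalField
import Mathlib.RingTheory.SimpleModule.Rank
import HarnessLib

/-!
# [Liu2021, App. D Lemma D.1 (1)] as printed — NON-VACUITY of the hypothesis set (kernel certificate)

Reproduction / bookkeeping (Literature, theorems only, no records, nothing asserted about Liu's objects): the
statement-exact record `Literature.NumberTheory.Automorphic.Liu2021.LemD1_1AsPrinted` (`LemD1AsPrinted.lean`) is a
predicate on a datum `LemD1Data F E n V` with many REAL constraints (a non-archimedean local field `F`, the tree's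
hardened standing data `OscillatorStandingData F E n`, characters `μ`, `χ` with norm-one / continuity / kernel
clauses, …).  This file certifies IN THE KERNEL that the constraint set together with the record is JOINTLY SATISFIABLE
at the Hodge/CM cells' rank `n = 3`: at a SPLIT place (`F = K_v` the completion of a number field at a finite place —
a non-archimedean local field by the tree's `AdicCompletionLocalField` —, `E = F × F` with the swap involution, the
tree's `SplitPlace.splitData`), with `ε = (1, −1)`, `μ = 1`, `χ = 1` and the carrier `ω(μ, ε)` instantiated by the
trivial representation on `ℂ`, the datum exists and `LemD1_1AsPrinted` HOLDS (the maximal `χ`-quotient is `ℂ`: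
irreducible, admissible, non-zero; `E` is not a field, so both sides of item (1) are false).  Consequence: no
contradiction is derivable from `(L : LemD1Data …) (h : LemD1_1AsPrinted L)` alone (T5-style consistency, our
bookkeeping; it says nothing about the truth of Lemma D.1 for Liu's `ω(μ, ε)`).

Reference (context): Y. Liu, *Fourier–Jacobi cycles and arithmetic relative trace formula*, Camb. J. Math. 9 (2021) =
arXiv:2102.11518, App. D §D.1, Lemma D.1 (`FJcycle.tex` l. 5226–5229); split case of the proof, l. 5241.
-/

noncomputable section

open Literature.RepresentationTheory.Liu2021 (OscillatorStandingData)
open Literature.RepresentationTheory.CentralCharacterQuotient (augmentation quotRep)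

namespace Literature.NumberTheory.Automorphic.Liu2021


namespace LemD1NonVacuity

open _root_.IsDedekindDomain _root_.NumberField
open Literature.RepresentationTheory.Liu2021.SplitPlace (splitData not_isField)

/-- **The hypothesis set of `LemD1_1AsPrinted` is jointly satisfiable at `n = 3`** (T5-style in-kernel certificate,
our bookkeeping): at a SPLIT place — `F = K_v` the completion of any number field `K` at any finite place `v` (a
non-archimedean local field: tree instance), `E = F × F` with the swap (the tree's `splitData`, Gram matrix `(1, 1)`),
`ε = (1, −1)`, `μ = 1`, `χ = 1`, and the carrier `ω(μ, ε) :=` the trivial representation on `ℂ` — the datum exists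
AND the record holds there (the maximal `χ`-quotient is `ℂ`, one-dimensional, hence irreducible and admissible; it is
non-zero and `E` is not a field, so both sides of item (1) are false).  No statement about Liu's objects.
[cite: Liu2021, App. D Lemma D.1 (1)] -/
theorem exists_lemD1Data_lemD1_1AsPrinted (K : Type) [Field K] [NumberField K] (v : HeightOneSpectrum (𝓞 K)) :
    ∃ L : LemD1Data (v.adicCompletion K) (v.adicCompletion K × v.adicCompletion K) 3 ℂ, LemD1_1AsPrinted L := by
  haveI hcz : CharZero (v.adicCompletion K) :=
    charZero_of_injective_algebraMap (algebraMap K (v.adicCompletion K)).injective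
  have h2 : ringChar (v.adicCompletion K) ≠ 2 := by
    rw [ringChar.eq_zero]; decide
  have hH : IsUnit (1 : Matrix (Fin 3) (Fin 3) (v.adicCompletion K)).det := by simp
  let S : OscillatorStandingData (v.adicCompletion K) (v.adicCompletion K × v.adicCompletion K) 3 :=
    splitData 1 hH (by norm_num) h2
  have hconj : ∀ x, S.conj x = x.swap := fun x => rfl
  let L : LemD1Data (v.adicCompletion K) (v.adicCompletion K × v.adicCompletion K) 3 ℂ :=
    { isNonarchimedeanLocalField := inferInstance
      isModuleTopology := inferInstance
      S := S
      eps := MulEquiv.prodUnits.symm (1, -1)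
      eps_mem_skew := by
        rw [S.mem_skew_iff, hconj]
        simp [MulEquiv.prodUnits]
      mu := 1
      norm_mu := fun x => by simp
      continuous_mu := by simpa using continuous_const
      mu_algebraMap_eq_one_iff := fun a => by
        refine ⟨fun _ => ⟨MulEquiv.prodUnits.symm (a, 1), ?_⟩, fun _ => by simp⟩
        rw [hconj]
        simp [MulEquiv.prodUnits, Prod.algebraMap_apply]
      chi := 1
      norm_chi := fun z => by simp
      continuous_chi := by simpa using continuous_const
      omega := Representation.trivial ℂ S.U ℂ }
  refine ⟨L, ?_⟩
  -- the augmentation submodule of the trivial datum is `⊥`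
  have hN : augmentation L.omega L.S.scalar L.chi = ⊥ := by
    change augmentation (Representation.trivial ℂ S.U ℂ) S.scalar (1 : S.normOne →* ℂˣ) = ⊥
    unfold augmentation
    refine iSup_eq_bot.2 fun z => ?_
    rw [LinearMap.range_eq_bot]
    ext
    simp
  have hfin : Module.finrank ℂ (ℂ ⧸ augmentation L.omega L.S.scalar L.chi) = 1 := by
    rw [(Submodule.quotEquivOfEqBot _ hN).finrank_eq, Module.finrank_self]
  haveI hsimple : IsSimpleModule ℂ (ℂ ⧸ augmentation L.omega L.S.scalar L.chi) :=
    isSimpleModule_iff_finrank_eq_one.2 hfin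
  have hact : ∀ (g : L.S.U) (x : ℂ ⧸ augmentation L.omega L.S.scalar L.chi), L.datum.quot g x = x := by
    intro g x
    obtain ⟨y, rfl⟩ := Submodule.Quotient.mk_surjective _ x
    rw [LemD1Data.datum_quot, Literature.RepresentationTheory.CentralCharacterQuotient.quotRep_mk]
    rfl
  refine ⟨⟨?_, ?_, ?_⟩, ?_⟩
  · -- irreducible-or-zero: submodules of a one-dimensional space
    intro W
    rcases eq_bot_or_eq_top W.toSubmodule with h | h
    · exact Or.inl (Subrepresentation.toSubmodule_injective h)
    · exact Or.inr (Subrepresentation.toSubmodule_injective h)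
  · -- smooth: every stabiliser is the whole group
    intro x
    have hstab : (L.datum.quot.stabilizerSubgroup x : Set L.S.U) = Set.univ := by
      ext g
      simp only [SetLike.mem_coe, Representation.mem_stabilizerSubgroup, Set.mem_univ, iff_true]
      exact hact g x
    change IsOpen (L.datum.quot.stabilizerSubgroup x : Set L.S.U)
    rw [hstab]
    exact isOpen_univ
  · -- finitely generated fixed vectors
    intro K _
    infer_instance
  · -- item (1): both sides are false
    refine iff_of_false ?_ ?_
    · rw [not_subsingleton_iff_nontrivial]
      exact Module.nontrivial_of_finrank_pos (R := ℂ) (by rw [hfin]; exact one_pos)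
    · exact fun h => not_isField (v.adicCompletion K) h.1

end LemD1NonVacuity

end Literature.NumberTheory.Automorphic.Liu2021

end
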